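import Summits.HodgeConjecture.CorCM.OcticWeil13PairPowersHodgeOfMarkman
import Summits.HodgeConjecture.CorCM.OcticWeilMixedHodgeOfMarkman
import Summits.HodgeConjecture.CorCM.OcticWeilOrbitFamilyHodgeOfMarkman
import HarnessLib

/-!
# COR-CM — the Hodge conjecture for every product of copies of `E`, a DEGENERATE simple CM fourfold `B` (`(2,2)`-type) and TWO
# CM fourfolds `B'₁, B'₂` of `k`-signature `(1,3)` SPLIT by `B` (the `τ`-member of `Φ'₁` inside `Φ_B`, that of `Φ'₂` outside),
# all with CM by the same octic field, GIVEN ONLY Markman's fourfold and hyperbolic-sixfold theorems: INTRINSIC and GEOMETRIC forms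

Cell `pub-hodgecm2` (COR-CM), seat b30 gen 21 (2026-08-22); count-neutral own lane OCTIC-WEIL-EIGHTFOLD — capstone of
`Census/OcticWeil13Pair(Parts)` → `CorCM/OcticWeil13PairFrameTransfer` → `…SixfoldParts` / `…EightfoldParts` (push-pull,
`CorCM/CMWeightPushforwardExtraction`) → `…PowersHodgeOfMarkman`.  Theorems only; no definition, no `sorry`; displayed named
facts: `Markman2025_weilClasses_algebraic_abelianFourfold`, `Markman2025_weilClasses_algebraic_hyperbolicSixfold`.

* §1 `exists_perm_of_pair_mem_not_mem` (relabeling by `decide`), `exists_frameP` — for `Φ` with two members over `τ`, `Φ'₁`,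
  `Φ'₂` with one member over `τ` each, the first INSIDE `Φ`, the second OUTSIDE: a frame `e` reading `Φ` as `I_0 = {0,1}`,
  `Φ'₁` at position `0`, `Φ'₂` at position `2` (the split normal form of the census);
* §2 **`hodgeConjectureFor_biproduct_comp_vec_of_markmanP`** (intrinsic, under `2`-transitivity `h2T`),
  **`hodgeConjectureFor_biproduct_comp_vec_of_isSimple_of_markmanP`** (`B` SIMPLE ⟹ `2`-transitivity, Dodson, gen 19's
  `OcticWeilFourfold.twoTransitive_of_isSimple`), and `…_of_avDominatedBy_…` (everything dominated).
WHAT IS NEW relative to gen 20's MIXED theorem (`OcticWeilMixed.hodgeConjectureFor_biproduct_comp_vec_of_isSimple_of_markmanM`,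
two `(2,2)` + one `(1,3)`): TWO `(1,3)`-types at once — the Hodge ring of `B'₁^{n₁} × B'₂^{n₂} × …` contains the Weil classes of
the EIGHTFOLDS `B'₁ × B̄'₂`, outside the reach of pull-backs of fourfold/sixfold Weil classes; they are reached by PUSH-FORWARD.
HONEST FRAMING: conditional on the two displayed Markman binders; nothing here asserts `HC_CM`.

## References
* [Markman2025SurveySecant] E. Markman, arXiv:2509.23403, Thm. 1.2, §11.5.  [Markman2025SecantWeil] E. Markman,
  arXiv:2502.03415, Thm 1.5.1.  [Dodson1984] B. Dodson, Trans. AMS 283 (1984), §3.3.2 Theorem.  [Deligne1982HodgeCycles]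
  LNM 900 (1982), §4 Prop. 4.4, §5 (b), (c).  [Shimura1998] G. Shimura, §8.2 Prop. 26, §18.2.  [Pohlmann1968] Ann. of Math.
  88 (1968), Thm 1.  [Schoen1998HodgeWeilAddendum] Compositio Math. 114 (1998), §10.  [MumfordAV1970] D. Mumford, §19.
-/

noncomputable section

open CategoryTheory CategoryTheory.Limits NumberField

namespace Summit.HodgeConjecture.CorCM.OcticWeil13Pair

open Literature.AlgebraicGeometry Literature.AlgebraicGeometry.Motives Literature.AlgebraicGeometry.HodgeTheory
open Literature.AlgebraicGeometry.ComplexMultiplication (IsCMTypeRealisation)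
open Literature.AlgebraicGeometry.Pohlmann1968
open Literature.AlgebraicTopology.SingularHomology
open Literature.NumberTheory.ComplexMultiplication
open Summit.HodgeConjecture.CorCM.Census.OcticWeilOrbit (signTab permTab permTab_facts)
open Summit.HodgeConjecture.CorCM.Census.OcticWeilMixed (signTabM signTabM_two)
open Summit.HodgeConjecture.CorCM.Census.OcticWeil13Pair (signTabP signTabP_zero signTabP_one signTabP_two)
open Summit.HodgeConjecture.CorCM.OcticWeilOrbit (card_filter_symm_true mem_iff_of_reading_true
  exists_realisation_of_reading)
open Summit.HodgeConjecture.CorCM.OcticWeilFourfold (exists_frame₂ h2t_of_twoTransitive twoTransitive_of_isSimple)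
open Summit.HodgeConjecture.CorCM.OcticWeilMixed (mem_iff_of_single)
open Summit.HodgeConjecture.CorCM.OcticCurveFourfold (exists_delta_of_mem)
open Summit.HodgeConjecture.CorCM.Census.OcticCurveFourfold (phi phiPre inr_mem_phiPre)
open Summit.HodgeConjecture.CorCM.OcticWeilOrbit (exists_cmType_of_frame hgal_of_h2t)
open Summit.HodgeConjecture.CorCM.Domination (AVDominatedBy)

open scoped Classical

/-! ## §1 The frame in split normal form -/

section Frame

/-- **The relabeling lemma**: a `2`-subset `T` of `Fin 4`, a point `a₁ ∈ T` and a point `a₂ ∉ T` are put by a permutation `σ`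
onto `I_0 = {0, 1}`, `0` and `2`. [folklore] -/
theorem exists_perm_of_pair_mem_not_mem : ∀ (T : Finset (Fin 4)) (a₁ a₂ : Fin 4), T.card = 2 → a₁ ∈ T → a₂ ∉ T →
    ∃ σ : Equiv.Perm (Fin 4), (∀ a : Fin 4, a ∈ T ↔ signTab 0 0 (σ a) = !false) ∧ σ a₁ = 0 ∧ σ a₂ = 2 := by
  unfold signTab
  decide +kernel

variable {K : Type} [Field K] [NumberField K] [IsCMField K] {k : Type} [Field k] [NumberField k]

omit [IsCMField K] in
/-- **THE FRAME EXISTS (split normal form).**  For `[K:ℚ] = 8`, `i : k → K`, `Hom(k, ℂ) = {τ, τ̄}`, a CM type `Φ` with two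
members over `τ`, and CM types `Φ'₁`, `Φ'₂` with ONE member over `τ` each, that of `Φ'₁` lying IN `Φ` and that of `Φ'₂` OUTSIDE
`Φ`: an enumeration `e` with `(e s).2 = [s ∘ i = τ]`, `e s̄ = ((e s).1, ¬(e s).2)`, reading `Φ` as `I_0` (straight, no flip),
`Φ'₁` as `Φ'_0` and `Φ'₂` as `Φ'_2`. [cite: Shimura1998, §18.2 Lemma] [cite: Dodson1984, §3.1.1] -/
theorem exists_frameP (h8 : Module.finrank ℚ K = 8) (h2 : Module.finrank ℚ k = 2) (i : k →+* K) {τ : k →+* ℂ}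
    (hττ : ComplexEmbedding.conjugate τ ≠ τ) (hk : ∀ σ : k →+* ℂ, σ = τ ∨ σ = ComplexEmbedding.conjugate τ)
    (Φ Φ'₁ Φ'₂ : CMType K)
    (h22 : (Finset.univ.filter fun s : K →+* ℂ => s.comp i = τ ∧ s ∈ Φ.1).card = 2)
    (h13₁ : (Finset.univ.filter fun s : K →+* ℂ => s.comp i = τ ∧ s ∈ Φ'₁.1).card = 1)
    (h13₂ : (Finset.univ.filter fun s : K →+* ℂ => s.comp i = τ ∧ s ∈ Φ'₂.1).card = 1)
    (hin : (Finset.univ.filter fun s : K →+* ℂ => s.comp i = τ ∧ (s ∈ Φ'₁.1 ∧ s ∈ Φ.1)).card = 1)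
    (hout : (Finset.univ.filter fun s : K →+* ℂ => s.comp i = τ ∧ (s ∈ Φ'₂.1 ∧ s ∈ Φ.1)).card = 0) :
    ∃ (e : (K →+* ℂ) ≃ Fin 4 × Bool), (∀ s, (e s).2 = true ↔ s.comp i = τ) ∧
      (∀ s, e (ComplexEmbedding.conjugate s) = ((e s).1, !(e s).2)) ∧
      (∀ s, s ∈ Φ.1 ↔ signTab 0 0 (e s).1 = ((e s).2 != false)) ∧
      (∀ s, s ∈ Φ'₁.1 ↔ (e s).2 = signTabM 0 0 2 (e s).1) ∧
      (∀ s, s ∈ Φ'₂.1 ↔ (e s).2 = signTabM 2 0 2 (e s).1) := by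
  obtain ⟨e₀, he₀_sign, he₀_conj, -⟩ := exists_frame₂ h8 h2 i hττ hk Φ h22
  set T₀ : Finset (Fin 4) := Finset.univ.filter fun a => e₀.symm (a, true) ∈ Φ.1 with hT₀
  have hT₀card : T₀.card = 2 := by rw [hT₀, card_filter_symm_true he₀_sign (fun s => s ∈ Φ.1)]; exact h22
  -- the unique `τ`-members of `Φ'₁`, `Φ'₂` and their labels
  have hlab : ∀ (Φ' : CMType K), (Finset.univ.filter fun s : K →+* ℂ => s.comp i = τ ∧ s ∈ Φ'.1).card = 1 →
      ∃ a₀ : Fin 4, ∀ a : Fin 4, e₀.symm (a, true) ∈ Φ'.1 ↔ a = a₀ := by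
    intro Φ' h13
    obtain ⟨a₀, ha₀⟩ := Finset.card_eq_one.1
      (show (Finset.univ.filter fun a : Fin 4 => e₀.symm (a, true) ∈ Φ'.1).card = 1 by
        rw [card_filter_symm_true he₀_sign (fun s => s ∈ Φ'.1)]; exact h13)
    refine ⟨a₀, fun a => ?_⟩
    have h : a ∈ (Finset.univ.filter fun a : Fin 4 => e₀.symm (a, true) ∈ Φ'.1) ↔ a ∈ ({a₀} : Finset (Fin 4)) := by
      rw [ha₀]
    simpa using h
  obtain ⟨a₁, ha₁⟩ := hlab Φ'₁ h13₁
  obtain ⟨a₂, ha₂⟩ := hlab Φ'₂ h13₂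
  have ha₁T : a₁ ∈ T₀ := by
    have h1 : (Finset.univ.filter fun a : Fin 4 => e₀.symm (a, true) ∈ Φ'₁.1 ∧ e₀.symm (a, true) ∈ Φ.1).card = 1 := by
      rw [card_filter_symm_true he₀_sign (fun s => s ∈ Φ'₁.1 ∧ s ∈ Φ.1)]; exact hin
    obtain ⟨a, ha⟩ := Finset.card_eq_one.1 h1
    have hamem : a ∈ Finset.univ.filter fun a : Fin 4 => e₀.symm (a, true) ∈ Φ'₁.1 ∧ e₀.symm (a, true) ∈ Φ.1 := by
      rw [ha]; exact Finset.mem_singleton_self a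
    obtain ⟨-, h₁, hΦ⟩ := Finset.mem_filter.1 hamem
    rw [(ha₁ a).1 h₁] at hΦ
    exact Finset.mem_filter.2 ⟨Finset.mem_univ _, hΦ⟩
  have ha₂T : a₂ ∉ T₀ := by
    intro h
    have hmem : a₂ ∈ Finset.univ.filter fun a : Fin 4 => e₀.symm (a, true) ∈ Φ'₂.1 ∧ e₀.symm (a, true) ∈ Φ.1 :=
      Finset.mem_filter.2 ⟨Finset.mem_univ _, (ha₂ a₂).2 rfl, (Finset.mem_filter.1 h).2⟩
    have h0 : (Finset.univ.filter fun a : Fin 4 => e₀.symm (a, true) ∈ Φ'₂.1 ∧ e₀.symm (a, true) ∈ Φ.1).card = 0 := by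
      rw [card_filter_symm_true he₀_sign (fun s => s ∈ Φ'₂.1 ∧ s ∈ Φ.1)]; exact hout
    rw [Finset.card_eq_zero] at h0
    rw [h0] at hmem
    exact Finset.notMem_empty _ hmem
  obtain ⟨σ, hσT, hσ₁, hσ₂⟩ := exists_perm_of_pair_mem_not_mem T₀ a₁ a₂ hT₀card ha₁T ha₂T
  -- the re-numbered frame
  let e : (K →+* ℂ) ≃ Fin 4 × Bool := e₀.trans (Equiv.prodCongr σ (Equiv.refl Bool))
  have he : ∀ s, e s = (σ (e₀ s).1, (e₀ s).2) := fun s => rfl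
  have he_conj : ∀ s, e (ComplexEmbedding.conjugate s) = ((e s).1, !(e s).2) := fun s => by rw [he, he, he₀_conj]
  have hsymm : ∀ b : Fin 4, e.symm (b, true) = e₀.symm (σ.symm b, true) := fun b => rfl
  refine ⟨e, fun s => by rw [he]; exact he₀_sign s, he_conj, ?_, ?_, ?_⟩
  · refine mem_iff_of_reading_true he_conj fun b => ?_
    have h := hσT (σ.symm b)
    rw [Equiv.apply_symm_apply] at h
    rw [hsymm, ← h, hT₀]
    simp
  · refine mem_iff_of_single he_conj fun b => ?_
    rw [hsymm, ha₁ (σ.symm b), Equiv.symm_apply_eq, hσ₁]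
  · refine mem_iff_of_single he_conj fun b => ?_
    rw [hsymm, ha₂ (σ.symm b), Equiv.symm_apply_eq, hσ₂]

end Frame

/-! ## §2 The intrinsic theorem (under `2`-transitivity) and the geometric theorem (`B` simple) -/

section Main

variable {K : Type} [Field K] [NumberField K] [IsCMField K] {k : Type} [Field k] [NumberField k] [IsCMField k] {N : ℕ}
  {Φ Φ'₁ Φ'₂ : CMType K} {B B'₁ B'₂ : AbelianVariety ℂ}
  {ιB : 𝓞 K →+* End B} {θB : K →+* Module.End ℂ (complexBetti B.X 1)}
  {ι₁ : 𝓞 K →+* End B'₁} {θ₁ : K →+* Module.End ℂ (complexBetti B'₁.X 1)}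
  {ι₂ : 𝓞 K →+* End B'₂} {θ₂ : K →+* Module.End ℂ (complexBetti B'₂.X 1)}
  {Ψ : CMType k} {E : AbelianVariety ℂ} {ιE : 𝓞 k →+* End E} {θE : k →+* Module.End ℂ (complexBetti E.X 1)}

/-- **THE HODGE CONJECTURE FOR EVERY PRODUCT OF COPIES OF `E, B, B'₁, B'₂`, GIVEN ONLY Markman's fourfold and sixfold
theorems** — `B ⊨ (K; Φ)` a CM abelian fourfold of `k`-signature `(2,2)`, `B'₁ ⊨ (K; Φ'₁)` and `B'₂ ⊨ (K; Φ'₂)` of `k`-signature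
`(1,3)` with the `τ`-member of `Φ'₁` in `Φ` (`hin`) and that of `Φ'₂` outside `Φ` (`hout`), `E ⊨ (k; Ψ ∋ τ)`, all over ONE CM
field `K` of degree `8`, and `Aut(ℂ)` `2`-TRANSITIVE on the four embeddings of `K` over `τ` (`h2T`; Dodson: automatic when `B`
is simple): for every `κ : Fin N → Fin 4`, every rational `(q,q)`-class on `⨁_j ![E, B, B'₁, B'₂] (κ j)` is algebraic.
[cite: Markman2025SurveySecant, Thm. 1.2] [cite: Markman2025SecantWeil, Thm 1.5.1] [cite: Pohlmann1968, Thm 1]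
[cite: Dodson1984, §3.3.2 Theorem] [cite: Deligne1982HodgeCycles, §5 (b), (c)] [cite: Schoen1998HodgeWeilAddendum, §10] -/
theorem hodgeConjectureFor_biproduct_comp_vec_of_markmanP
    (hW4 : Markman2025_weilClasses_algebraic_abelianFourfold) (hM6 : Markman2025_weilClasses_algebraic_hyperbolicSixfold)
    (h8 : Module.finrank ℚ K = 8) (h2 : Module.finrank ℚ k = 2) (i : k →+* K)
    (hB : IsCMTypeRealisation Φ B ιB θB) (hB₁ : IsCMTypeRealisation Φ'₁ B'₁ ι₁ θ₁)
    (hB₂ : IsCMTypeRealisation Φ'₂ B'₂ ι₂ θ₂) (hE : IsCMTypeRealisation Ψ E ιE θE)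
    {τ : k →+* ℂ} (hτΨ : τ ∈ Ψ.1)
    (h22 : (Finset.univ.filter fun s : K →+* ℂ => s.comp i = τ ∧ s ∈ Φ.1).card = 2)
    (h13₁ : (Finset.univ.filter fun s : K →+* ℂ => s.comp i = τ ∧ s ∈ Φ'₁.1).card = 1)
    (h13₂ : (Finset.univ.filter fun s : K →+* ℂ => s.comp i = τ ∧ s ∈ Φ'₂.1).card = 1)
    (hin : (Finset.univ.filter fun s : K →+* ℂ => s.comp i = τ ∧ (s ∈ Φ'₁.1 ∧ s ∈ Φ.1)).card = 1)
    (hout : (Finset.univ.filter fun s : K →+* ℂ => s.comp i = τ ∧ (s ∈ Φ'₂.1 ∧ s ∈ Φ.1)).card = 0)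
    (h2T : ∀ s t s' t' : K →+* ℂ, s.comp i = τ → t.comp i = τ → s'.comp i = τ → t'.comp i = τ → s ≠ t → s' ≠ t' →
      ∃ ρ : ℂ ≃+* ℂ, (ρ : ℂ →+* ℂ).comp s = s' ∧ (ρ : ℂ →+* ℂ).comp t = t')
    (κ : Fin N → Fin 4) :
    HodgeConjectureFor (⨁ fun j => (![E, B, B'₁, B'₂] : Fin 4 → AbelianVariety ℂ) (κ j)).dim
      (⨁ fun j => (![E, B, B'₁, B'₂] : Fin 4 → AbelianVariety ℂ) (κ j)).X := by
  have hττ : ComplexEmbedding.conjugate τ ≠ τ := QuarticCM.conjugate_ne τ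
  have hk : ∀ σ : k →+* ℂ, σ = τ ∨ σ = ComplexEmbedding.conjugate τ := fun σ =>
    QuarticCM.eq_or_eq_conjugate_of_quadratic h2 τ σ
  have hΨ : ∀ σ : k →+* ℂ, σ ∈ Ψ.1 ↔ σ = τ := by
    intro σ
    rcases hk σ with rfl | rfl
    · exact ⟨fun _ => rfl, fun _ => hτΨ⟩
    · exact ⟨fun h => absurd h ((Ψ.2 τ).1 hτΨ), fun h => absurd h hττ⟩
  -- `√−d ∈ 𝓞_k` with `τ(√−d) = i√d`
  obtain ⟨δ₀, d, hd, hδ₀⟩ := CyclicSextic.exists_sq_eq_neg_nat_of_isTotallyComplex k h2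
  obtain ⟨δ, hδ, hτ⟩ := exists_delta_of_mem h2 hd hδ₀ τ
  -- the frame in split normal form; the straight reading of `Φ`
  obtain ⟨e, he_sign, he_conj, hr, hr₁, hr₂⟩ := exists_frameP h8 h2 i hττ hk Φ Φ'₁ Φ'₂ h22 h13₁ h13₂ hin hout
  obtain ⟨Φ', ιB', θB', hB', hΦ'⟩ := exists_realisation_of_reading he_conj hr hB
  have hΦP : ∀ s, s ∈ Φ'.1 ↔ (e s).2 = signTabP 0 0 (e s).1 := fun s => by rw [signTabP_zero]; exact hΦ' s
  have hΦ₁P : ∀ s, s ∈ Φ'₁.1 ↔ (e s).2 = signTabP 0 1 (e s).1 := fun s => by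
    rw [signTabP_one, ← signTabM_two]; exact hr₁ s
  have hΦ₂P : ∀ s, s ∈ Φ'₂.1 ↔ (e s).2 = signTabP 0 2 (e s).1 := fun s => by
    rw [signTabP_two, ← signTabM_two]; exact hr₂ s
  have h2t := h2t_of_twoTransitive he_sign h2T
  -- the family `Kf = (k, K)` and the four slots `(k, K, K, K)`
  let Kf : Fin 2 → Type := Fin.cons k fun _ : Fin 1 => K
  letI instF : ∀ j, Field (Kf j) := fun j =>
    Fin.cases (motive := fun j => Field (Kf j)) ‹Field k› (fun _ => ‹Field K›) j
  letI instN : ∀ j, NumberField (Kf j) := fun j =>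
    Fin.cases (motive := fun j => NumberField (Kf j)) ‹NumberField k› (fun _ => ‹NumberField K›) j
  haveI instC : ∀ j, IsCMField (Kf j) := fun j =>
    Fin.cases (motive := fun j => IsCMField (Kf j)) ‹IsCMField k› (fun _ => ‹IsCMField K›) j
  exact hodgeConjectureFor_biproduct_comp_of_frameP_of_markman_h2t (Kf := Kf) (i₀ := 0) (i₁ := 1)
    (A₄ := ![E, B, B'₁, B'₂])
    (Φ₄ := Fin.cons Ψ (Fin.cons Φ' (Fin.cons Φ'₁ (Fin.cons Φ'₂ finZeroElim))))
    (ι₄ := Fin.cons ιE (Fin.cons ιB' (Fin.cons ι₁ (Fin.cons ι₂ finZeroElim))))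
    (θ₄ := Fin.cons θE (Fin.cons θB' (Fin.cons θ₁ (Fin.cons θ₂ finZeroElim)))) hW4 hM6 κ h8 h2 i hd hδ hτ
    (Fin.cases hE (Fin.cases hB' (Fin.cases hB₁ (Fin.cases hB₂ fun l => l.elim0)))) e he_sign he_conj
    (Fin.cases hΦP (Fin.cases hΦ₁P (Fin.cases hΦ₂P fun l => l.elim0))) hΨ h2t

/-- **THE GEOMETRIC FORM: `B` SIMPLE.**  For a SIMPLE CM abelian fourfold `B ⊨ (K; Φ)` of `k`-signature `(2,2)` (a DEGENERATE
simple CM fourfold; Dodson: `Gal(Kᶜ/k)` acts `2`-transitively on the four embeddings over `τ`), two CM fourfolds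
`B'₁ ⊨ (K; Φ'₁)`, `B'₂ ⊨ (K; Φ'₂)` of `k`-signature `(1,3)` split by `Φ` (e.g. two suitable Galois conjugates of ONE simple CM
fourfold of primitive type), and the CM curve `E ⊨ (k; Ψ ∋ τ)`: the Hodge conjecture for EVERY product of copies of
`E, B, B'₁, B'₂`, GIVEN ONLY Markman's fourfold and hyperbolic-sixfold theorems. [cite: Markman2025SurveySecant, Thm. 1.2]
[cite: Markman2025SecantWeil, Thm 1.5.1] [cite: Dodson1984, §3.3.2 Theorem] [cite: Shimura1998, §8.2 Prop. 26]
[cite: Pohlmann1968, Thm 1 and §3] [cite: Schoen1998HodgeWeilAddendum, §10] -/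
theorem hodgeConjectureFor_biproduct_comp_vec_of_isSimple_of_markmanP
    (hW4 : Markman2025_weilClasses_algebraic_abelianFourfold) (hM6 : Markman2025_weilClasses_algebraic_hyperbolicSixfold)
    (h8 : Module.finrank ℚ K = 8) (h2 : Module.finrank ℚ k = 2) (i : k →+* K)
    (hB : IsCMTypeRealisation Φ B ιB θB) (hS : B.IsSimple) (hB₁ : IsCMTypeRealisation Φ'₁ B'₁ ι₁ θ₁)
    (hB₂ : IsCMTypeRealisation Φ'₂ B'₂ ι₂ θ₂) (hE : IsCMTypeRealisation Ψ E ιE θE)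
    {τ : k →+* ℂ} (hτΨ : τ ∈ Ψ.1)
    (h22 : (Finset.univ.filter fun s : K →+* ℂ => s.comp i = τ ∧ s ∈ Φ.1).card = 2)
    (h13₁ : (Finset.univ.filter fun s : K →+* ℂ => s.comp i = τ ∧ s ∈ Φ'₁.1).card = 1)
    (h13₂ : (Finset.univ.filter fun s : K →+* ℂ => s.comp i = τ ∧ s ∈ Φ'₂.1).card = 1)
    (hin : (Finset.univ.filter fun s : K →+* ℂ => s.comp i = τ ∧ (s ∈ Φ'₁.1 ∧ s ∈ Φ.1)).card = 1)
    (hout : (Finset.univ.filter fun s : K →+* ℂ => s.comp i = τ ∧ (s ∈ Φ'₂.1 ∧ s ∈ Φ.1)).card = 0)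
    (κ : Fin N → Fin 4) :
    HodgeConjectureFor (⨁ fun j => (![E, B, B'₁, B'₂] : Fin 4 → AbelianVariety ℂ) (κ j)).dim
      (⨁ fun j => (![E, B, B'₁, B'₂] : Fin 4 → AbelianVariety ℂ) (κ j)).X :=
  hodgeConjectureFor_biproduct_comp_vec_of_markmanP hW4 hM6 h8 h2 i hB hB₁ hB₂ hE hτΨ h22 h13₁ h13₂ hin hout
    (twoTransitive_of_isSimple h8 h2 i hB hS τ h22) κ

/-- **… and for every abelian variety dominated by such a product** (isogeny factors, quotients, abelian subvarieties of some
`E^a × B^n × B'₁^{n₁} × B'₂^{n₂}`). [cite: Markman2025SurveySecant, Thm. 1.2] [cite: Markman2025SecantWeil, Thm 1.5.1]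
[cite: MumfordAV1970, §19] -/
theorem hodgeConjectureFor_of_avDominatedBy_comp_vec_of_isSimple_of_markmanP
    (hW4 : Markman2025_weilClasses_algebraic_abelianFourfold) (hM6 : Markman2025_weilClasses_algebraic_hyperbolicSixfold)
    (h8 : Module.finrank ℚ K = 8) (h2 : Module.finrank ℚ k = 2) (i : k →+* K)
    (hB : IsCMTypeRealisation Φ B ιB θB) (hS : B.IsSimple) (hB₁ : IsCMTypeRealisation Φ'₁ B'₁ ι₁ θ₁)
    (hB₂ : IsCMTypeRealisation Φ'₂ B'₂ ι₂ θ₂) (hE : IsCMTypeRealisation Ψ E ιE θE)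
    {τ : k →+* ℂ} (hτΨ : τ ∈ Ψ.1)
    (h22 : (Finset.univ.filter fun s : K →+* ℂ => s.comp i = τ ∧ s ∈ Φ.1).card = 2)
    (h13₁ : (Finset.univ.filter fun s : K →+* ℂ => s.comp i = τ ∧ s ∈ Φ'₁.1).card = 1)
    (h13₂ : (Finset.univ.filter fun s : K →+* ℂ => s.comp i = τ ∧ s ∈ Φ'₂.1).card = 1)
    (hin : (Finset.univ.filter fun s : K →+* ℂ => s.comp i = τ ∧ (s ∈ Φ'₁.1 ∧ s ∈ Φ.1)).card = 1)
    (hout : (Finset.univ.filter fun s : K →+* ℂ => s.comp i = τ ∧ (s ∈ Φ'₂.1 ∧ s ∈ Φ.1)).card = 0)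
    (κ : Fin N → Fin 4) {C : AbelianVariety ℂ}
    (hC : Domination.AVDominatedBy C (⨁ fun j => (![E, B, B'₁, B'₂] : Fin 4 → AbelianVariety ℂ) (κ j))) :
    HodgeConjectureFor C.dim C.X :=
  Domination.hodgeConjectureFor_of_avDominatedBy
    (hodgeConjectureFor_biproduct_comp_vec_of_isSimple_of_markmanP hW4 hM6 h8 h2 i hB hS hB₁ hB₂ hE hτΨ h22 h13₁ h13₂ hin
      hout κ) hC

/-! ## §3 Without `B`: any two `(1,3)`-types with distinct `τ`-members -/

/-- The gen-18 type `phi` of the `10`-point model read on the labels: `inr q ∈ phi ⟺ q.2 = [q.1 = 0]`. [folklore] -/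
theorem inr_mem_phi_iff_decide : ∀ q : Fin 4 × Bool, (Sum.inr q ∈ phi) ↔ q.2 = decide (q.1 = 0) := by
  intro q
  rw [show phi = phiPre (0, true) from rfl, inr_mem_phiPre]
  revert q
  decide

/-- **Relabeling fixing `0`**: a label `a₂ ≠ 0` is moved to `2` by a permutation fixing `0`. [folklore] -/
theorem exists_perm_fix_zero : ∀ a₂ : Fin 4, a₂ ≠ 0 → ∃ σ : Equiv.Perm (Fin 4), σ 0 = 0 ∧ σ a₂ = 2 := by
  decide +kernel

/-- **THE HODGE CONJECTURE FOR EVERY PRODUCT OF COPIES OF `E, B'₁, B'₂` — ANY two CM abelian fourfolds with CM by one octic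
field `K ⊇ i(k)`, of `k`-signature `(1,3)`, with DISTINCT members over `τ` (`hdist`; e.g. two different Galois conjugates of
one simple CM fourfold of primitive type) — GIVEN ONLY Markman's hyperbolic-SIXFOLD theorem and `2`-transitivity of
`Aut(ℂ)` on the four embeddings over `τ`** (`h2T`: the relative quartic `K/k` has Galois group `A₄` or `S₄`; automatic when
`K` carries a degenerate simple CM fourfold, Dodson).  The `(2,2)`-type splitting the two positions and its realisation `B`
are supplied by the frame (`exists_cmType_of_frame`) and the tree's `cmAbelianVarietyRealised_holds`; no Weil part of `B`
occurs on products avoiding it (`hodgeConjectureFor_biproduct_comp_of_frameP_of_markmanSixfold`), and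
`⨁ ![E, B'₁, B'₂] ∘ κ ≅ ⨁ ![E, B, B'₁, B'₂] ∘ (0,2,3) ∘ κ` (`biproduct.mapIso` of `eqToIso`s).  The Hodge rings here contain the
EIGHTFOLD Weil classes of `B'₁ × B̄'₂`, reached by PUSH-FORWARD (`CorCM/CMWeightPushforwardExtraction`).
[cite: Markman2025SecantWeil, Thm 1.5.1] [cite: Pohlmann1968, Thm 1] [cite: Dodson1984, §3.3.2 Theorem]
[cite: Schoen1998HodgeWeilAddendum, §10] [cite: MumfordAV1970, §19] -/
theorem hodgeConjectureFor_biproduct_comp_vec₃_of_markmanSixfold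
    (hM6 : Markman2025_weilClasses_algebraic_hyperbolicSixfold)
    (h8 : Module.finrank ℚ K = 8) (h2 : Module.finrank ℚ k = 2) (i : k →+* K)
    (hB₁ : IsCMTypeRealisation Φ'₁ B'₁ ι₁ θ₁) (hB₂ : IsCMTypeRealisation Φ'₂ B'₂ ι₂ θ₂) (hE : IsCMTypeRealisation Ψ E ιE θE)
    {τ : k →+* ℂ} (hτΨ : τ ∈ Ψ.1)
    (h13₁ : (Finset.univ.filter fun s : K →+* ℂ => s.comp i = τ ∧ s ∈ Φ'₁.1).card = 1)
    (h13₂ : (Finset.univ.filter fun s : K →+* ℂ => s.comp i = τ ∧ s ∈ Φ'₂.1).card = 1)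
    (hdist : (Finset.univ.filter fun s : K →+* ℂ => s.comp i = τ ∧ (s ∈ Φ'₁.1 ∧ s ∈ Φ'₂.1)).card = 0)
    (h2T : ∀ s t s' t' : K →+* ℂ, s.comp i = τ → t.comp i = τ → s'.comp i = τ → t'.comp i = τ → s ≠ t → s' ≠ t' →
      ∃ ρ : ℂ ≃+* ℂ, (ρ : ℂ →+* ℂ).comp s = s' ∧ (ρ : ℂ →+* ℂ).comp t = t')
    (κ : Fin N → Fin 3) :
    HodgeConjectureFor (⨁ fun j => (![E, B'₁, B'₂] : Fin 3 → AbelianVariety ℂ) (κ j)).dim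
      (⨁ fun j => (![E, B'₁, B'₂] : Fin 3 → AbelianVariety ℂ) (κ j)).X := by
  have hττ : ComplexEmbedding.conjugate τ ≠ τ := QuarticCM.conjugate_ne τ
  have hk : ∀ σ : k →+* ℂ, σ = τ ∨ σ = ComplexEmbedding.conjugate τ := fun σ =>
    QuarticCM.eq_or_eq_conjugate_of_quadratic h2 τ σ
  have hΨ : ∀ σ : k →+* ℂ, σ ∈ Ψ.1 ↔ σ = τ := by
    intro σ
    rcases hk σ with rfl | rfl
    · exact ⟨fun _ => rfl, fun _ => hτΨ⟩
    · exact ⟨fun h => absurd h ((Ψ.2 τ).1 hτΨ), fun h => absurd h hττ⟩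
  obtain ⟨δ₀, d, hd, hδ₀⟩ := CyclicSextic.exists_sq_eq_neg_nat_of_isTotallyComplex k h2
  obtain ⟨δ, hδ, hτ⟩ := exists_delta_of_mem h2 hd hδ₀ τ
  -- a frame reading `Φ'₁` at label `0`
  obtain ⟨e₀, he₀_sign, he₀_conj, hr₀⟩ := OcticCurveFourfold.exists_frame h8 h2 i hττ hk Φ'₁ h13₁
  have hread₁ : ∀ s, s ∈ Φ'₁.1 ↔ (e₀ s).2 = decide ((e₀ s).1 = 0) := fun s =>
    (hr₀ s).trans (inr_mem_phi_iff_decide (e₀ s))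
  -- the label `a₂ ≠ 0` of the `τ`-member of `Φ'₂`
  obtain ⟨a₂, ha₂'⟩ := Finset.card_eq_one.1
    (show (Finset.univ.filter fun a : Fin 4 => e₀.symm (a, true) ∈ Φ'₂.1).card = 1 by
      rw [card_filter_symm_true he₀_sign (fun s => s ∈ Φ'₂.1)]; exact h13₂)
  have ha₂ : ∀ a : Fin 4, e₀.symm (a, true) ∈ Φ'₂.1 ↔ a = a₂ := fun a => by
    have h : a ∈ (Finset.univ.filter fun a : Fin 4 => e₀.symm (a, true) ∈ Φ'₂.1) ↔ a ∈ ({a₂} : Finset (Fin 4)) := by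
      rw [ha₂']
    simpa using h
  have ha₂0 : a₂ ≠ 0 := by
    rintro rfl
    have h1 : e₀.symm (0, true) ∈ Φ'₁.1 := by rw [hread₁, Equiv.apply_symm_apply]; decide
    have hmem : e₀.symm (0, true) ∈ Finset.univ.filter fun s : K →+* ℂ => s.comp i = τ ∧ (s ∈ Φ'₁.1 ∧ s ∈ Φ'₂.1) :=
      Finset.mem_filter.2 ⟨Finset.mem_univ _, (he₀_sign _).1 (by rw [Equiv.apply_symm_apply]), h1, (ha₂ 0).2 rfl⟩
    rw [Finset.card_eq_zero] at hdist
    rw [hdist] at hmem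
    exact Finset.notMem_empty _ hmem
  obtain ⟨σ, hσ0, hσ2⟩ := exists_perm_fix_zero a₂ ha₂0
  -- the re-numbered frame: `Φ'₁` at `0`, `Φ'₂` at `2`
  let e : (K →+* ℂ) ≃ Fin 4 × Bool := e₀.trans (Equiv.prodCongr σ (Equiv.refl Bool))
  have he : ∀ s, e s = (σ (e₀ s).1, (e₀ s).2) := fun s => rfl
  have he_sign : ∀ s, (e s).2 = true ↔ s.comp i = τ := fun s => by rw [he]; exact he₀_sign s
  have he_conj : ∀ s, e (ComplexEmbedding.conjugate s) = ((e s).1, !(e s).2) := fun s => by rw [he, he, he₀_conj]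
  have hsymm : ∀ b : Fin 4, e.symm (b, true) = e₀.symm (σ.symm b, true) := fun b => rfl
  -- the `(2,2)`-type `I_0` of the frame and a realisation `B`
  obtain ⟨Φ, hΦ⟩ := exists_cmType_of_frame he_conj 0
  obtain ⟨B, ιB, θB, hB⟩ := cmAbelianVarietyRealised_holds K Φ
  have hΦP : ∀ s, s ∈ Φ.1 ↔ (e s).2 = signTabP 0 0 (e s).1 := fun s => by rw [signTabP_zero]; exact hΦ s
  have hΦ₁P : ∀ s, s ∈ Φ'₁.1 ↔ (e s).2 = signTabP 0 1 (e s).1 := fun s => by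
    rw [signTabP_one, permTab_facts.2.2, hread₁ s, he]
    have hiff : σ (e₀ s).1 = 0 ↔ (e₀ s).1 = 0 :=
      ⟨fun h => σ.injective (h.trans hσ0.symm), fun h => by rw [h, hσ0]⟩
    by_cases h0 : (e₀ s).1 = 0
    · rw [decide_eq_true h0, decide_eq_true (show id (σ (e₀ s).1) = 0 from hiff.2 h0)]
    · rw [decide_eq_false h0, decide_eq_false (show ¬ id (σ (e₀ s).1) = 0 from fun h => h0 (hiff.1 h))]
  have hΦ₂P : ∀ s, s ∈ Φ'₂.1 ↔ (e s).2 = signTabP 0 2 (e s).1 := fun s => by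
    rw [signTabP_two, ← signTabM_two]
    exact mem_iff_of_single he_conj (fun b => by rw [hsymm, ha₂ (σ.symm b), Equiv.symm_apply_eq, hσ2]) s
  have h2t := h2t_of_twoTransitive he_sign h2T
  -- the four-atom product along `(0,2,3) ∘ κ`: no `B`, sixfold theorem only
  let ρ : Fin 3 → Fin 4 := ![0, 2, 3]
  have hρ1 : ∀ l : Fin 3, ρ l ≠ 1 := by decide
  let Kf : Fin 2 → Type := Fin.cons k fun _ : Fin 1 => K
  letI instF : ∀ j, Field (Kf j) := fun j =>
    Fin.cases (motive := fun j => Field (Kf j)) ‹Field k› (fun _ => ‹Field K›) j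
  letI instN : ∀ j, NumberField (Kf j) := fun j =>
    Fin.cases (motive := fun j => NumberField (Kf j)) ‹NumberField k› (fun _ => ‹NumberField K›) j
  haveI instC : ∀ j, IsCMField (Kf j) := fun j =>
    Fin.cases (motive := fun j => IsCMField (Kf j)) ‹IsCMField k› (fun _ => ‹IsCMField K›) j
  have hbig : HodgeConjectureFor (⨁ fun j => (![E, B, B'₁, B'₂] : Fin 4 → AbelianVariety ℂ) (ρ (κ j))).dim
      (⨁ fun j => (![E, B, B'₁, B'₂] : Fin 4 → AbelianVariety ℂ) (ρ (κ j))).X :=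
    hodgeConjectureFor_biproduct_comp_of_frameP_of_markmanSixfold (Kf := Kf) (i₀ := 0) (i₁ := 1)
      (A₄ := ![E, B, B'₁, B'₂])
      (Φ₄ := Fin.cons Ψ (Fin.cons Φ (Fin.cons Φ'₁ (Fin.cons Φ'₂ finZeroElim))))
      (ι₄ := Fin.cons ιE (Fin.cons ιB (Fin.cons ι₁ (Fin.cons ι₂ finZeroElim))))
      (θ₄ := Fin.cons θE (Fin.cons θB (Fin.cons θ₁ (Fin.cons θ₂ finZeroElim)))) hM6 (fun j => ρ (κ j))
      (fun j => hρ1 (κ j)) h8 h2 i hd hδ hτ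
      (Fin.cases hE (Fin.cases hB (Fin.cases hB₁ (Fin.cases hB₂ fun l => l.elim0)))) e he_sign he_conj
      (Fin.cases hΦP (Fin.cases hΦ₁P (Fin.cases hΦ₂P fun l => l.elim0))) hΨ (hgal_of_h2t he_sign h2t)
  -- re-index: `⨁ ![E, B'₁, B'₂] ∘ κ ≅ ⨁ ![E, B, B'₁, B'₂] ∘ ρ ∘ κ`
  have hρA : ∀ l : Fin 3, (![E, B'₁, B'₂] : Fin 3 → AbelianVariety ℂ) l =
      (![E, B, B'₁, B'₂] : Fin 4 → AbelianVariety ℂ) (ρ l) := by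
    intro l; fin_cases l <;> rfl
  exact Domination.hodgeConjectureFor_of_avDominatedBy hbig
    (AVDominatedBy.of_iso (biproduct.mapIso fun j => eqToIso (hρA (κ j))) (AVDominatedBy.refl _))

/-- **… and for every abelian variety dominated by such a product** (e.g. `E^a × B'₁^{n₁} × B'₂^{n₂}` and all its isogeny
factors). [cite: Markman2025SecantWeil, Thm 1.5.1] [cite: MumfordAV1970, §19] -/
theorem hodgeConjectureFor_of_avDominatedBy_comp_vec₃_of_markmanSixfold
    (hM6 : Markman2025_weilClasses_algebraic_hyperbolicSixfold)
    (h8 : Module.finrank ℚ K = 8) (h2 : Module.finrank ℚ k = 2) (i : k →+* K)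
    (hB₁ : IsCMTypeRealisation Φ'₁ B'₁ ι₁ θ₁) (hB₂ : IsCMTypeRealisation Φ'₂ B'₂ ι₂ θ₂) (hE : IsCMTypeRealisation Ψ E ιE θE)
    {τ : k →+* ℂ} (hτΨ : τ ∈ Ψ.1)
    (h13₁ : (Finset.univ.filter fun s : K →+* ℂ => s.comp i = τ ∧ s ∈ Φ'₁.1).card = 1)
    (h13₂ : (Finset.univ.filter fun s : K →+* ℂ => s.comp i = τ ∧ s ∈ Φ'₂.1).card = 1)
    (hdist : (Finset.univ.filter fun s : K →+* ℂ => s.comp i = τ ∧ (s ∈ Φ'₁.1 ∧ s ∈ Φ'₂.1)).card = 0)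
    (h2T : ∀ s t s' t' : K →+* ℂ, s.comp i = τ → t.comp i = τ → s'.comp i = τ → t'.comp i = τ → s ≠ t → s' ≠ t' →
      ∃ ρ : ℂ ≃+* ℂ, (ρ : ℂ →+* ℂ).comp s = s' ∧ (ρ : ℂ →+* ℂ).comp t = t')
    (κ : Fin N → Fin 3) {C : AbelianVariety ℂ}
    (hC : AVDominatedBy C (⨁ fun j => (![E, B'₁, B'₂] : Fin 3 → AbelianVariety ℂ) (κ j))) :
    HodgeConjectureFor C.dim C.X :=
  Domination.hodgeConjectureFor_of_avDominatedBy
    (hodgeConjectureFor_biproduct_comp_vec₃_of_markmanSixfold hM6 h8 h2 i hB₁ hB₂ hE hτΨ h13₁ h13₂ hdist h2T κ) hC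

end Main

end Summit.HodgeConjecture.CorCM.OcticWeil13Pair

end
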